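/- Copyright: the b2b-balaban cell (near-miss cell 7), T⁴-continuum fan-out, lineage t4-ne7b-formalise-leaf-04 (NE7b
ROUND-2 crew, leaf prover 04).  Released under the licence of the surrounding project. -/
import Summits.QuantumFields.BalabanUV.T4Continuum.Support.B16HistoryIndexedRepr

/-!
# Sanity for (α)-M1: the index skeleton and the relative (1.72) data are inhabited NON-VACUOUSLY and the expansion
theorem COMPUTES — re-open object (α) of row NE7b, `SCOPE-alpha.md` v2.2 §5 row M1, companion of
`B16RelPosOp` ∕ `B16HistoryIndexedRepr`; lineage `t4-ne7b-formalise-leaf-04` gen 23 (owner's INTERFACE REQUEST IR-41-1)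

Summits-side support leaf of the T⁴-continuum cell (rung (B)+1 on a FINITE torus only; NOT infinite volume, NOT the
mass gap, NOT Clay; NOT a proof of NE7b — the cell's OWN estimate, NOT PRINTED, NOT PROVED).  [folklore] decided toy
arithmetic; nothing printed asserted, no `def … : Prop` fact of Bałaban's, no cite-tagged hypothesis, zero `sorry`.

A toy level over `C = Unit`, `Dom = ℕ`, the class of ALL functions (`GoodClass.top`): two outer summands — the all-small
one and one with a new region `Z_k = {7}` whose TWO histories `h ∈ {0, 1}` act by the finite kernels `×2`, `×3`
(`RelLinPosOp.ofPosOp` of gen 4's `PosOp.mulOp`); one sub-history choice; two curly summands; `χ ≡ 1`, `A′ ≡ 0`, `V ≡ 0`.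
KERNEL-DECIDED: (S1) the skeleton's fields are jointly satisfiable with distinct summands (`index_inj` non-trivial);
(S2) `term true = (2 + 3)·e⁰·(e⁰ + e⁰) = 10`, `term false = 2`, and THE EXPANSION THEOREM computes the same `10` as the sum
of the `2 × 1 × 2 = 4` elementary terms; one elementary term `= 3`; (S3) the toy density `ρ ≡ 12` satisfies «(1.72)
holds» and, by `holds_iff_sum_eterm`, `12 = Σ_a Σ_ι eterm`; (S4) `abs_eterm_le` with exact weights (bound attained).

HONEST.  Proves nothing of Bałaban's; BY-NAME EFFECT ON THE WALL: NONE; NE7b NOT proved; spine 0∕9.  HONEST DEPENDENCY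
(cell): continuum YM on T⁴ ⇐ BetaPertH ∧ nine spine estimates (0/9 proved); BetaPertH ⇐ (D1) ∧ (D4) ∧ CAP+tail; G-an2-4
gates asym, D1 and NE2/3/4.  This file changes none of it.
-/

open Finset
open Literature.MathematicalPhysics.QuantumFieldTheory.Balaban1983to89
open Literature.MathematicalPhysics.QuantumFieldTheory.Balaban1983to89.B16Cor3Ops

namespace Summit.QuantumFields.BalabanUV.T4Continuum.B16HistoryIndexedRepr.Sanity

open RelLinPosOp Repr172R HIndex

/-- "multiply by the constant `c ≥ 0`" as a relative operation on all functions (a one-point kernel). [folklore] -/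
def cmul (c : ℝ) (hc : 0 ≤ c) : RelLinPosOp (GoodClass.top Unit) :=
  RelLinPosOp.ofPosOp (PosOp.mulOp (fun _ => c) (fun _ => hc)) fun F G x => by
    show c * (F x + G x) = c * F x + c * G x
    ring

/-- The toy INDEX SKELETON (`reducible`: the checks below compute through it). [folklore] -/
@[reducible] def toyI : HIndex ℕ where
  Adm := Bool
  Zc a := if a then {7} else ∅
  Ys _ := ∅
  index_inj a b h _ := by
    cases a <;> cases b <;> simp_all
  HZ := Fin 2
  HL := Unit
  HC := Fin 2
  HZs a := if a then Finset.univ else {0}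
  HYs _ := {()}
  HCs _ := Finset.univ
  allSmall := false
  Zc_allSmall := rfl
  Ys_allSmall := rfl
  hz₀ := 0
  HZs_allSmall := rfl
  hl₀ := ()
  HYs_allSmall := rfl

/-- The toy OPERATIONS over `toyI`, relative to the class of all functions. [folklore] -/
noncomputable def toy : Repr172R (GoodClass.top Unit) toyI where
  χ _ _ := 1
  A' _ := 0
  TZh a h := if a then (if h = 0 then cmul 2 (by norm_num) else cmul 3 (by norm_num)) else RelLinPosOp.idR _
  TYl _ _ := RelLinPosOp.idR _
  TC _ _ := RelLinPosOp.idR _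
  Vs _ _ _ _ _ := 0
  χ_good _ := trivial
  expA_good := trivial
  E_good _ _ _ _ := trivial
  TZh_allSmall _ := rfl
  TYl_allSmall _ := rfl

/-- (S1) the two outer summands are distinct (`index_inj` separates them by `Zc`). [folklore] -/
example : toyI.Zc true ≠ toyI.Zc false := by
  show ({7} : Finset ℕ) ≠ ∅
  exact Finset.singleton_ne_empty 7

/-- (S2a) the large summand's term evaluates to `(2 + 3) · e⁰ · (e⁰ + e⁰) = 10`. [folklore] -/
theorem term_true : toy.term true () = 10 := by
  show (1 : ℝ) * ∑ h ∈ (Finset.univ : Finset (Fin 2)),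
      (if h = 0 then cmul 2 (by norm_num) else cmul 3 (by norm_num)).T
        (fun _ => Real.exp 0 * ∑ l ∈ ({()} : Finset Unit),
          (RelLinPosOp.idR (GoodClass.top Unit)).T (fun _ => ∑ c ∈ (Finset.univ : Finset (Fin 2)),
            (RelLinPosOp.idR (GoodClass.top Unit)).T (fun _ => Real.exp 0) ()) ()) () = 10
  simp only [Fin.sum_univ_two, Finset.sum_singleton, Real.exp_zero, RelLinPosOp.idR, cmul, RelLinPosOp.ofPosOp,
    PosOp.mulOp, if_true, show (1 : Fin 2) ≠ 0 from by decide, if_false]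
  norm_num

/-- (S2a′) the all-small term evaluates to `1 · e⁰ · (e⁰ + e⁰) = 2`. [folklore] -/
theorem term_false : toy.term false () = 2 := by
  show (1 : ℝ) * ∑ h ∈ ({0} : Finset (Fin 2)),
      (RelLinPosOp.idR (GoodClass.top Unit)).T
        (fun _ => Real.exp 0 * ∑ l ∈ ({()} : Finset Unit),
          (RelLinPosOp.idR (GoodClass.top Unit)).T (fun _ => ∑ c ∈ (Finset.univ : Finset (Fin 2)),
            (RelLinPosOp.idR (GoodClass.top Unit)).T (fun _ => Real.exp 0) ()) ()) () = 2
  simp only [Fin.sum_univ_two, Finset.sum_singleton, Real.exp_zero, RelLinPosOp.idR]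
  norm_num

/-- (S2b) THE EXPANSION THEOREM on the toy: the large term is the sum of its 4 elementary terms (`2+2+3+3 = 10`). [folklore] -/
example : ∑ ι ∈ toyI.LIdx true, toy.eterm true ι () = 10 := by
  rw [← Repr172R.term_eq_sum_eterm]
  exact term_true

/-- (S2c) one elementary term: history `h = 1` (`×3`), curly summand `c = 0`, weighs `3`. [folklore] -/
theorem eterm_one_zero : toy.eterm true ((1 : Fin 2), (), (0 : Fin 2)) () = 3 := by
  show (1 : ℝ) * (if (1 : Fin 2) = 0 then cmul 2 (by norm_num) else cmul 3 (by norm_num)).T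
      (fun _ => Real.exp 0 * (RelLinPosOp.idR (GoodClass.top Unit)).T
        ((RelLinPosOp.idR (GoodClass.top Unit)).T (fun _ => Real.exp 0)) ()) () = 3
  simp only [Real.exp_zero, RelLinPosOp.idR, cmul, RelLinPosOp.ofPosOp, PosOp.mulOp,
    show (1 : Fin 2) ≠ 0 from by decide, if_false]
  norm_num

/-- (S3) «(1.72) holds» for the toy density `ρ ≡ 12 = 2 + 10`. [folklore] -/
theorem toy_holds : ∀ V : Unit, (12 : ℝ) = ∑ a : toyI.Adm, toy.term a V := by
  intro V
  cases V
  have h : ∑ b : Bool, toy.term b () = 12 := by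
    rw [Fintype.sum_bool, term_true, term_false]
    norm_num
  exact h.symm

/-- (S3′) … hence `12 = Σ_a Σ_{ι ∈ LIdx a} eterm a ι` by `holds_iff_sum_eterm`. [folklore] -/
example : ∀ V, (12 : ℝ) = ∑ a : toyI.Adm, ∑ ι ∈ toyI.LIdx a, toy.eterm a ι V :=
  (Repr172R.holds_iff_sum_eterm toy (fun _ => 12)).mp toy_holds

/-- (S4) `abs_eterm_le` with the exact per-operation weights `wZ = 3`, `wY = wC = 1`, `BA = BV = 0` — attained. [folklore] -/
example : |toy.eterm true ((1 : Fin 2), (), (0 : Fin 2)) ()| ≤ 3 * (Real.exp 0 * (1 * (1 * Real.exp 0))) :=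
  Repr172R.abs_eterm_le toy true ((1 : Fin 2), (), (0 : Fin 2))
    (fun _ => ⟨zero_le_one, le_rfl⟩)
    (fun _ => by
      show (if (1 : Fin 2) = 0 then cmul 2 (by norm_num) else cmul 3 (by norm_num)).T (fun _ => 1) () ≤ 3
      simp only [show (1 : Fin 2) ≠ 0 from by decide, if_false, cmul, RelLinPosOp.ofPosOp, PosOp.mulOp, mul_one, le_refl])
    (fun _ => le_of_eq rfl) (fun _ => le_of_eq rfl) (fun _ => le_rfl) (fun _ => le_rfl) ()

end Summit.QuantumFields.BalabanUV.T4Continuum.B16HistoryIndexedRepr.Sanity
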